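import Summits.NavierStokesRegularity.NavierStokesRegularity.Theses.PlaneEnergyCeiling
import Summits.NavierStokesRegularity.NavierStokesRegularity.Theorems.PlaneEnergyCeilingBoundedPlanarEnergyRegularityGlue
import Summits.NavierStokesRegularity.NavierStokesRegularity.Theorems.PlaneEnergyCeilingBoundedPlanarEnergyRegularityStubPlanarEnergyZoom

/-!
# Route PlaneEnergyCeiling · crux `PlanarEnergyZoomA` (stmt-NavierStokesRegularity-16915) — proved

The Clay-(A)-form velocity-record zoom `PlanarEnergyZoomA` (rank-5 crux of the route
`PlaneEnergyCeiling`, a hypothesis of its deciding theorem `closes`) follows from two landed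
theorems of the sibling crux `BoundedPlanarEnergyRegularity`:

* `BoundedPlanarEnergyRegularity.stub_planarEnergyZoom`
  (`Theorems/PlaneEnergyCeilingBoundedPlanarEnergyRegularityStubPlanarEnergyZoom.lean`): the
  extension-form zoom — a classical Leray–Hopf solution from a rapidly decaying datum with no smooth
  extension past `T` and planar energies bounded on `[0,T)` yields a non-zero bounded ancient mild
  solution (`ν = 1`), measurable, jointly smooth on `(−∞,0) × ℝ³`, with bounded planar energies
  (KNSS 2009 Prop. 6.1 zoom at near-record points, `ν` normalised, planar Fatou);
* `BoundedPlanarEnergyRegularity.planarEnergyZoomA_of_planarEnergyZoom`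
  (`Theorems/PlaneEnergyCeilingBoundedPlanarEnergyRegularityGlue.lean`): extension form ⇒ (A)-form,
  through the per-datum local Clay theory `stub_localClayTheory` (if Clay (A) fails for `u₀`, some
  classical Leray–Hopf solution from `u 0 = u₀` has no smooth extension past some `T > 0`).

References: Koch–Nadirashvili–Seregin–Šverák 2009 (Prop. 6.1); Seregin–Šverák 2009;
Albritton–Barker 2019; Lemarié-Rieusset 2016 (Thm. 15.1). [KNSS2009] [SereginSverak2009]
-/

noncomputable section

-- single-conjunct summit: `Summit.<Summit>.<Problem>` repeats the name by the D-0017 layout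
set_option linter.dupNamespace false

namespace Summit.NavierStokesRegularity.NavierStokesRegularity.Theorems

/-- **Crux `PlanarEnergyZoomA` (stmt-NavierStokesRegularity-16915), proved.** For `ν > 0` and a
smooth divergence-free rapidly decaying datum `u₀`: if every classical Leray–Hopf solution from
`u 0 = u₀` has planar kinetic energies bounded on its interval `[0,T)` (every `T`) and Clay (A)
fails for `u₀`, then there is a non-zero bounded ancient mild solution (`ν = 1`), with measurable
slices, jointly smooth on `(−∞,0) × ℝ³`, whose planar energies are bounded uniformly in `t`, `R`,
`c`. Proof: the extension-form zoom `stub_planarEnergyZoom` fed into the glue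
`planarEnergyZoomA_of_planarEnergyZoom` (local Clay theory + planar hypothesis on `[0,T)`). -/
theorem planarEnergyZoomA_proof :
    Summit.NavierStokesRegularity.NavierStokesRegularity.Theses.PlaneEnergyCeiling.PlanarEnergyZoomA :=
  BoundedPlanarEnergyRegularity.planarEnergyZoomA_of_planarEnergyZoom
    BoundedPlanarEnergyRegularity.stub_planarEnergyZoom

end Summit.NavierStokesRegularity.NavierStokesRegularity.Theorems

end
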